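import Literature.MathematicalPhysics.QuantumFieldTheory.Balaban1983to89.T4Covariance
import HarnessLib

/-!
# Route `UnitScaleTilt`, crux K1 child «MinimiserStabilityRegPr» (stmt-QuantumFields-19200), leaf V2′ `stub_halvingStep` — pillar P3b
# ([Balaban1985Variational] PROP. 4 AT BACKGROUND 1), PART 2: **BOND–PLAQUETTE INCIDENCE ON THE SETUP TORUS** — the sum over plaquettes as a
# triple sum, the `2(d−1)` plaquettes through a bond listed as (plane, ±) PAIRS with the bond in slots (1,3) or (4,2), the translation
# invariance `Σ_p (∂δ)(p) = 0` of the linear plaquette variable, and the shift bookkeeping of the paired plaquettes (torus combinatorics only)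

Cell `ym3-torus` (HUMAN RULING D-0037, YM ladder rung R3), width seat `ym-ust-19200-w5` gen 0 (OWNER ym3-torus-plan g24, W-SEAT MAP pass #2: «w5 = P3b»).
`--supports stmt-QuantumFields-19200 --as helper`; count-neutral.  YM₃ on T³ is a ladder rung (R3), not the Clay problem; nothing here is a claim about the
crux, d = 4 or the mass gap.

WHY.  The functional derivative (98) of [Balaban1985Variational] Prop. 4 at a bond `b = ⟨x, μ⟩` is a sum over the plaquettes `p ∋ b`; at background 1
the third-order term is `O(|A′|²)` only after pairing, for every `ν ≠ μ`, the two plaquettes of the `(μ,ν)`-plane through `b` — `p_{μν}(x)` (where `b` is the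
FIRST edge) with `p_{μν}(x − e_ν)` (where `b` is the THIRD edge) if `μ < ν`, and `p_{νμ}(x)` (FOURTH edge) with `p_{νμ}(x − e_ν)` (SECOND edge) if `ν < μ` —
whose other edges differ by the translation `−e_ν` ((93)–(96): «a simple difference operation»).  THIS FILE is that bookkeeping on the tree's torus
`Site P j` ∕ `Plaq P j` (`Setup`), with the edge convention of `GaugeField.plaqHol` (`b₁ = ⟨x,μ⟩`, `b₂ = ⟨x+e_μ,ν⟩`, `b₃ = ⟨x+e_ν,μ⟩`, `b₄ = ⟨x,ν⟩`):
* §1 torus sites (`Site.shift_unshift`∕`unshift_shift` are the tree's, `T4Covariance`): commutation `unshift_shift_comm`, `shift_eq_iff_eq_unshift`.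
* §2 **`sum_plaq_eq_sum_triple_dite`** — `Σ_p g p = Σ_x Σ_μ Σ_ν (if h : μ < ν then g ⟨x,μ,ν,h⟩ else 0)`; the four SLOT SUMS `sum_plaq_ite_slot1…4`
  (`Σ_p [bᵢ(p) = b]·g p` as a single sum over the transverse direction); **`sum_plaq_slots_eq_pairs`** — their total as the sum over `ν` of the (±) pairs.
* §3 **`sum_plaq_curl_eq_zero`** — `Σ_p (δ(b₁) + δ(b₂) − δ(b₃) − δ(b₄)) = 0` for every bond field `δ` with values in an additive commutative group (the two
  translations `p ↦ p + e_ν`, `p ↦ p + e_μ` of `Plaq P j` are bijections): the LINEAR term of the action expansion vanishes identically at background 1.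
HONEST SCOPE.  Finite combinatorics of the periodic lattice ([folklore]); no analysis, no gauge fields.  Sorry-free, no definition, axioms standard.

References: T. Bałaban, CMP **102** (1985) 277–309 [Balaban1985Variational] (93)–(96) p.292; CMP **98** (1985) 17–51 [Balaban1985Averaging] (5), (9) pp.18–19
(bonds, plaquettes).
-/

set_option autoImplicit false

open scoped BigOperators
open Finset

namespace Summit.QuantumFields.YangMills.Theorems.FlatPlaqIncidence

open Literature.MathematicalPhysics.QuantumFieldTheory.Balaban1983to89
open Site (shift_unshift unshift_shift)

variable {P : Params} {j : ℕ}

/-! ## §1 Torus sites -/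

/-- `x′ + e_ν = x ↔ x′ = x − e_ν`. [folklore] -/
theorem shift_eq_iff_eq_unshift (x x' : Site P j) (ν : Fin P.d) : x'.shift ν = x ↔ x' = x.unshift ν := by
  constructor
  · rintro rfl; rw [unshift_shift]
  · rintro rfl; rw [shift_unshift]

/-- Translations commute: `(x − e_ν) + e_μ = (x + e_μ) − e_ν`. [folklore] -/
theorem unshift_shift_comm (x : Site P j) (μ ν : Fin P.d) : (x.unshift ν).shift μ = (x.shift μ).unshift ν := by
  funext κ
  simp only [Site.shift, Site.unshift, Function.update_apply]
  by_cases h1 : κ = μ <;> by_cases h2 : κ = ν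
  · subst h1; subst h2; simp
  · subst h1; simp [h2]
  · subst h2; simp [h1]
  · simp [h1, h2]

/-! ## §2 Sums over plaquettes: the triple sum and the four slot sums at a bond -/

/-- **A sum over positively oriented plaquettes is a triple sum over `(x, μ, ν)` restricted to `μ < ν`.** [folklore] -/
theorem sum_plaq_eq_sum_triple_dite {M : Type*} [AddCommMonoid M] (g : Plaq P j → M) :
    ∑ p : Plaq P j, g p = ∑ x : Site P j, ∑ μ : Fin P.d, ∑ ν : Fin P.d, (if h : μ < ν then g ⟨x, μ, ν, h⟩ else 0) := by
  classical
  set ι : Plaq P j → Site P j × Fin P.d × Fin P.d := fun p => (p.src, p.μ, p.ν) with hι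
  set G : Site P j × Fin P.d × Fin P.d → M := fun t => if h : t.2.1 < t.2.2 then g ⟨t.1, t.2.1, t.2.2, h⟩ else 0 with hG
  have hinj : Set.InjOn ι (univ : Finset (Plaq P j)) := by
    rintro ⟨x, μ, ν, h⟩ _ ⟨x', μ', ν', h'⟩ _ hpq
    simp only [hι, Prod.mk.injEq] at hpq
    obtain ⟨rfl, rfl, rfl⟩ := hpq
    rfl
  have h1 : ∑ p : Plaq P j, g p = ∑ p : Plaq P j, G (ι p) := by
    refine sum_congr rfl fun p _ => ?_
    simp only [hG, hι, dif_pos p.hμν]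
  have h2 : ∑ p : Plaq P j, G (ι p) = ∑ t ∈ (univ : Finset (Plaq P j)).image ι, G t := by rw [sum_image hinj]
  have h3 : ∑ t ∈ (univ : Finset (Plaq P j)).image ι, G t = ∑ t : Site P j × Fin P.d × Fin P.d, G t := by
    refine sum_subset (subset_univ _) fun t _ ht => ?_
    simp only [hG]
    split_ifs with h
    · exact absurd (mem_image.mpr ⟨(⟨t.1, t.2.1, t.2.2, h⟩ : Plaq P j), mem_univ _, rfl⟩) ht
    · rfl
  rw [h1, h2, h3, Fintype.sum_prod_type]
  exact sum_congr rfl fun x _ => Fintype.sum_prod_type _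

/-- Slot 1: the plaquettes whose FIRST edge is `b = ⟨x, μ⟩` are the `p_{μν}(x)`, `μ < ν`. [folklore] -/
theorem sum_plaq_ite_slot1 {M : Type*} [AddCommMonoid M] [DecidableEq (PBond P j)] (g : Plaq P j → M) (b : PBond P j) :
    ∑ p : Plaq P j, (if (⟨p.src, p.μ⟩ : PBond P j) = b then g p else 0) =
      ∑ ν : Fin P.d, (if h : b.dir < ν then g ⟨b.src, b.dir, ν, h⟩ else 0) := by
  classical
  rw [sum_plaq_eq_sum_triple_dite]
  have hkey : ∀ (x : Site P j) (μ ν : Fin P.d),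
      (if h : μ < ν then (if (⟨x, μ⟩ : PBond P j) = b then g ⟨x, μ, ν, h⟩ else 0) else 0) =
      if μ = b.dir then (if x = b.src then (if h : b.dir < ν then g ⟨b.src, b.dir, ν, h⟩ else 0) else 0) else 0 := by
    intro x μ ν
    by_cases hμ : μ = b.dir
    · subst hμ
      by_cases hx : x = b.src
      · subst hx; simp
      · rw [if_pos rfl, if_neg hx]
        split_ifs with h1 h2
        · exact absurd (by cases b; simp only [PBond.mk.injEq] at h2; exact h2.1) hx
        · rfl
        · rfl
    · rw [if_neg hμ]
      split_ifs with h1 h2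
      · exact absurd (by cases b; simp only [PBond.mk.injEq] at h2; exact h2.2) hμ
      · rfl
      · rfl
  simp_rw [hkey]
  calc ∑ x : Site P j, ∑ μ : Fin P.d, ∑ ν : Fin P.d,
        (if μ = b.dir then (if x = b.src then (if h : b.dir < ν then g ⟨b.src, b.dir, ν, h⟩ else 0) else 0) else 0)
      = ∑ ν : Fin P.d, ∑ x : Site P j, ∑ μ : Fin P.d,
        (if μ = b.dir then (if x = b.src then (if h : b.dir < ν then g ⟨b.src, b.dir, ν, h⟩ else 0) else 0) else 0) := by
          exact (sum_congr rfl fun x _ => sum_comm).trans sum_comm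
    _ = _ := by simp only [sum_ite_eq', mem_univ, if_true]

/-- Slot 4: the plaquettes whose FOURTH edge is `b = ⟨x, μ⟩` are the `p_{νμ}(x)`, `ν < μ`. [folklore] -/
theorem sum_plaq_ite_slot4 {M : Type*} [AddCommMonoid M] [DecidableEq (PBond P j)] (g : Plaq P j → M) (b : PBond P j) :
    ∑ p : Plaq P j, (if (⟨p.src, p.ν⟩ : PBond P j) = b then g p else 0) =
      ∑ ν : Fin P.d, (if h : ν < b.dir then g ⟨b.src, ν, b.dir, h⟩ else 0) := by
  classical
  rw [sum_plaq_eq_sum_triple_dite]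
  have hkey : ∀ (x : Site P j) (μ ν : Fin P.d),
      (if h : μ < ν then (if (⟨x, ν⟩ : PBond P j) = b then g ⟨x, μ, ν, h⟩ else 0) else 0) =
      if ν = b.dir then (if x = b.src then (if h : μ < b.dir then g ⟨b.src, μ, b.dir, h⟩ else 0) else 0) else 0 := by
    intro x μ ν
    by_cases hν : ν = b.dir
    · subst hν
      by_cases hx : x = b.src
      · subst hx; simp
      · rw [if_pos rfl, if_neg hx]
        split_ifs with h1 h2
        · exact absurd (by cases b; simp only [PBond.mk.injEq] at h2; exact h2.1) hx
        · rfl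
        · rfl
    · rw [if_neg hν]
      split_ifs with h1 h2
      · exact absurd (by cases b; simp only [PBond.mk.injEq] at h2; exact h2.2) hν
      · rfl
      · rfl
  simp_rw [hkey]
  rw [sum_comm]
  simp only [sum_ite_eq', mem_univ, if_true]

/-- Slot 3: the plaquettes whose THIRD edge is `b = ⟨x, μ⟩` are the `p_{μν}(x − e_ν)`, `μ < ν`. [folklore] -/
theorem sum_plaq_ite_slot3 {M : Type*} [AddCommMonoid M] [DecidableEq (PBond P j)] (g : Plaq P j → M) (b : PBond P j) :
    ∑ p : Plaq P j, (if (⟨p.src.shift p.ν, p.μ⟩ : PBond P j) = b then g p else 0) =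
      ∑ ν : Fin P.d, (if h : b.dir < ν then g ⟨b.src.unshift ν, b.dir, ν, h⟩ else 0) := by
  classical
  rw [sum_plaq_eq_sum_triple_dite]
  have hkey : ∀ (x : Site P j) (μ ν : Fin P.d),
      (if h : μ < ν then (if (⟨x.shift ν, μ⟩ : PBond P j) = b then g ⟨x, μ, ν, h⟩ else 0) else 0) =
      if μ = b.dir then (if x = b.src.unshift ν then (if h : b.dir < ν then g ⟨b.src.unshift ν, b.dir, ν, h⟩ else 0) else 0) else 0 := by
    intro x μ ν
    by_cases hμ : μ = b.dir
    · subst hμ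
      by_cases hx : x = b.src.unshift ν
      · subst hx; simp [shift_unshift]
      · rw [if_pos rfl, if_neg hx]
        split_ifs with h1 h2
        · exact absurd (by rw [← shift_eq_iff_eq_unshift]; cases b; simp only [PBond.mk.injEq] at h2; exact h2.1) hx
        · rfl
        · rfl
    · rw [if_neg hμ]
      split_ifs with h1 h2
      · exact absurd (by cases b; simp only [PBond.mk.injEq] at h2; exact h2.2) hμ
      · rfl
      · rfl
  simp_rw [hkey]
  calc ∑ x : Site P j, ∑ μ : Fin P.d, ∑ ν : Fin P.d,
        (if μ = b.dir then (if x = b.src.unshift ν then (if h : b.dir < ν then g ⟨b.src.unshift ν, b.dir, ν, h⟩ else 0) else 0) else 0)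
      = ∑ ν : Fin P.d, ∑ x : Site P j, ∑ μ : Fin P.d,
        (if μ = b.dir then (if x = b.src.unshift ν then (if h : b.dir < ν then g ⟨b.src.unshift ν, b.dir, ν, h⟩ else 0) else 0) else 0) := by
          exact (sum_congr rfl fun x _ => sum_comm).trans sum_comm
    _ = _ := by simp only [sum_ite_eq', mem_univ, if_true]

/-- Slot 2: the plaquettes whose SECOND edge is `b = ⟨x, μ⟩` are the `p_{νμ}(x − e_ν)`, `ν < μ`. [folklore] -/
theorem sum_plaq_ite_slot2 {M : Type*} [AddCommMonoid M] [DecidableEq (PBond P j)] (g : Plaq P j → M) (b : PBond P j) :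
    ∑ p : Plaq P j, (if (⟨p.src.shift p.μ, p.ν⟩ : PBond P j) = b then g p else 0) =
      ∑ ν : Fin P.d, (if h : ν < b.dir then g ⟨b.src.unshift ν, ν, b.dir, h⟩ else 0) := by
  classical
  rw [sum_plaq_eq_sum_triple_dite]
  have hkey : ∀ (x : Site P j) (μ ν : Fin P.d),
      (if h : μ < ν then (if (⟨x.shift μ, ν⟩ : PBond P j) = b then g ⟨x, μ, ν, h⟩ else 0) else 0) =
      if ν = b.dir then (if x = b.src.unshift μ then (if h : μ < b.dir then g ⟨b.src.unshift μ, μ, b.dir, h⟩ else 0) else 0) else 0 := by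
    intro x μ ν
    by_cases hν : ν = b.dir
    · subst hν
      by_cases hx : x = b.src.unshift μ
      · subst hx; simp [shift_unshift]
      · rw [if_pos rfl, if_neg hx]
        split_ifs with h1 h2
        · exact absurd (by rw [← shift_eq_iff_eq_unshift]; cases b; simp only [PBond.mk.injEq] at h2; exact h2.1) hx
        · rfl
        · rfl
    · rw [if_neg hν]
      split_ifs with h1 h2
      · exact absurd (by cases b; simp only [PBond.mk.injEq] at h2; exact h2.2) hν
      · rfl
      · rfl
  simp_rw [hkey]
  rw [sum_comm]
  simp only [sum_ite_eq', mem_univ, if_true]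

/-- **THE PLAQUETTES THROUGH A BOND, AS (PLANE, ±) PAIRS.**  For any plaquette function `g` and bond `b = ⟨x, μ⟩`, the sum of `g` over the
plaquettes having `b` as an edge, counted slot by slot, equals the sum over the transverse directions `ν` of the PAIRS: for `μ < ν` the plaquettes
`p_{μν}(x)` (slot 1) and `p_{μν}(x − e_ν)` (slot 3), for `ν < μ` the plaquettes `p_{νμ}(x − e_ν)` (slot 2) and `p_{νμ}(x)` (slot 4).
[cite: Balaban1985Variational, (93)-(96) p.292] -/
theorem sum_plaq_slots_eq_pairs {M : Type*} [AddCommMonoid M] [DecidableEq (PBond P j)] (g : Plaq P j → M) (b : PBond P j) :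
    ∑ p : Plaq P j, ((if (⟨p.src, p.μ⟩ : PBond P j) = b then g p else 0) + (if (⟨p.src.shift p.μ, p.ν⟩ : PBond P j) = b then g p else 0)
      + (if (⟨p.src.shift p.ν, p.μ⟩ : PBond P j) = b then g p else 0) + (if (⟨p.src, p.ν⟩ : PBond P j) = b then g p else 0)) =
      ∑ ν : Fin P.d, ((if h : b.dir < ν then g ⟨b.src, b.dir, ν, h⟩ + g ⟨b.src.unshift ν, b.dir, ν, h⟩ else 0)
        + (if h : ν < b.dir then g ⟨b.src.unshift ν, ν, b.dir, h⟩ + g ⟨b.src, ν, b.dir, h⟩ else 0)) := by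
  classical
  calc _ = (∑ p : Plaq P j, if (⟨p.src, p.μ⟩ : PBond P j) = b then g p else 0)
        + (∑ p : Plaq P j, if (⟨p.src.shift p.μ, p.ν⟩ : PBond P j) = b then g p else 0)
        + (∑ p : Plaq P j, if (⟨p.src.shift p.ν, p.μ⟩ : PBond P j) = b then g p else 0)
        + (∑ p : Plaq P j, if (⟨p.src, p.ν⟩ : PBond P j) = b then g p else 0) := by
          simp only [sum_add_distrib]
    _ = (∑ ν : Fin P.d, if h : b.dir < ν then g ⟨b.src, b.dir, ν, h⟩ else 0)
        + (∑ ν : Fin P.d, if h : ν < b.dir then g ⟨b.src.unshift ν, ν, b.dir, h⟩ else 0)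
        + (∑ ν : Fin P.d, if h : b.dir < ν then g ⟨b.src.unshift ν, b.dir, ν, h⟩ else 0)
        + (∑ ν : Fin P.d, if h : ν < b.dir then g ⟨b.src, ν, b.dir, h⟩ else 0) := by
          rw [sum_plaq_ite_slot1, sum_plaq_ite_slot2, sum_plaq_ite_slot3, sum_plaq_ite_slot4]
    _ = ∑ ν : Fin P.d, ((if h : b.dir < ν then g ⟨b.src, b.dir, ν, h⟩ else 0)
        + (if h : ν < b.dir then g ⟨b.src.unshift ν, ν, b.dir, h⟩ else 0)
        + (if h : b.dir < ν then g ⟨b.src.unshift ν, b.dir, ν, h⟩ else 0)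
        + (if h : ν < b.dir then g ⟨b.src, ν, b.dir, h⟩ else 0)) := by
          simp only [sum_add_distrib]
    _ = _ := by
          refine sum_congr rfl fun ν _ => ?_
          by_cases h1 : b.dir < ν
          · have h2 : ¬ ν < b.dir := fun h => lt_asymm h1 h
            simp only [dif_pos h1, dif_neg h2, add_zero]
          · by_cases h2 : ν < b.dir
            · simp only [dif_neg h1, dif_pos h2, zero_add, add_zero]
            · simp only [dif_neg h1, dif_neg h2, add_zero]

/-! ## §3 The linear plaquette variable sums to zero over the torus -/

/-- **`Σ_p (δ(b₁) + δ(b₂) − δ(b₃) − δ(b₄)) = 0`** for every bond field `δ` (translating a plaquette by `e_ν`, resp. `e_μ`, is a bijection of `Plaq P j`,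
so `Σ_p δ(b₃(p)) = Σ_p δ(b₁(p))` and `Σ_p δ(b₂(p)) = Σ_p δ(b₄(p))`): the linear term of the Wilson action at background 1 vanishes identically.
[cite: Balaban1985Variational, (26)-(27) p.282] -/
theorem sum_plaq_curl_eq_zero {V : Type*} [AddCommGroup V] (δ : PBond P j → V) :
    ∑ p : Plaq P j, (δ ⟨p.src, p.μ⟩ + δ ⟨p.src.shift p.μ, p.ν⟩ - δ ⟨p.src.shift p.ν, p.μ⟩ - δ ⟨p.src, p.ν⟩) = 0 := by
  -- translation by `e_ν` and by `e_μ` as permutations of the plaquettes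
  let σν : Plaq P j ≃ Plaq P j :=
    { toFun := fun p => ⟨p.src.shift p.ν, p.μ, p.ν, p.hμν⟩
      invFun := fun p => ⟨p.src.unshift p.ν, p.μ, p.ν, p.hμν⟩
      left_inv := fun p => by cases p; simp [unshift_shift]
      right_inv := fun p => by cases p; simp [shift_unshift] }
  let σμ : Plaq P j ≃ Plaq P j :=
    { toFun := fun p => ⟨p.src.shift p.μ, p.μ, p.ν, p.hμν⟩
      invFun := fun p => ⟨p.src.unshift p.μ, p.μ, p.ν, p.hμν⟩
      left_inv := fun p => by cases p; simp [unshift_shift]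
      right_inv := fun p => by cases p; simp [shift_unshift] }
  have h3 : ∑ p : Plaq P j, δ ⟨p.src.shift p.ν, p.μ⟩ = ∑ p : Plaq P j, δ ⟨p.src, p.μ⟩ :=
    Equiv.sum_comp σν (fun p => δ ⟨p.src, p.μ⟩)
  have h2 : ∑ p : Plaq P j, δ ⟨p.src.shift p.μ, p.ν⟩ = ∑ p : Plaq P j, δ ⟨p.src, p.ν⟩ :=
    Equiv.sum_comp σμ (fun p => δ ⟨p.src, p.ν⟩)
  simp only [sum_sub_distrib, sum_add_distrib, h3, h2]
  abel

end Summit.QuantumFields.YangMills.Theorems.FlatPlaqIncidence
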